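import Mathlib
import Literature.Analysis.FluidPDE.SpaceTimeCalculus
import Literature.Analysis.FluidPDE.ClassicalSolutionCalculus
import Literature.Analysis.FluidPDE.EnstrophySplitting
import Literature.Analysis.FluidPDE.VectorCalculus
import Summits.NavierStokesRegularity.NavierStokesRegularity.Theorems.SymmetryModuliCountLinearLiouvilleSevenGalileanModeRegular
import HarnessLib

/-!
# Modulated Galilean modes of a Navier–Stokes pair: the linearised momentum equation

Registered stub `stub_galileanModeMomentum` (B2b) of the lead's skeleton for crux
stmt-NavierStokesRegularity-4054 (`SymmetryModuliCount.LinearLiouvilleSeven`), line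
`galilean-collapse`, Part B (the structural collapse `LL7 → X`).

For a classical Navier–Stokes pair `(u, p)`, jointly smooth on `(−∞, 0) × ℝ³`, in the tree's
convention `∂ₜu + (u·∇)u = Δu − ∇p` (`convect a b x = Db(x)[a x]`), a fixed vector `e` and a
modulation `φ` smooth on `t < 0`, the **modulated Galilean mode**
`v(t, x) = φ'(t) e − φ(t) ∂ₑu(t, x)`, `q(t, x) = −φ''(t)⟪e, x⟫ − φ(t) ∂ₑp(t, x)`
(the `θ`-derivative at `θ = 0` of the generalised Galilean symmetry
`u(t, x − θφ(t)e) + θφ'(t)e`) solves the **linearised momentum equation**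
`∂ₜv + (u·∇)v + (v·∇)u = Δv − ∇q` on `t < 0` (the Galilean Jacobi identity).

Computation (all at a fixed `t < 0`, `x`; `′ = d/dt`, `∂ₑ = D(·)[e]`):
* `∂ₜv = φ''e − φ'∂ₑu − φ ∂ₑ(∂ₜu)` (exchange `∂ₜ∂ₑ = ∂ₑ∂ₜ` for the jointly smooth `u` on the open
  time set, `IsSmoothSpaceTimeOn.hasDerivAt_fderiv_slice`);
* `(u·∇)v = −φ D(∂ₑu)[u]`, `(v·∇)u = φ'∂ₑu − φ Du[∂ₑu]`;
* `∂ₑ((u·∇)u) = D(∂ₑu)[u] + Du[∂ₑu]` (`fderiv_clm_apply` and Schwarz);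
* `Δv = −φ Δ(∂ₑu) = −φ ∂ₑ(Δu)` (`fderiv_laplacian_apply_of_contDiff_three`);
* `∇q = −φ''e − φ ∇(∂ₑp)` and `∇(∂ₑp) = ∂ₑ(∇p)` (Schwarz through the Riesz isometry);
* summing, `LHS − RHS = −φ ∂ₑ[∂ₜu + (u·∇)u − Δu + ∇p] = 0`, the bracket vanishing identically
  in `x` by the Navier–Stokes equations.
-/

noncomputable section

open Set Function InnerProductSpace
open scoped ContDiff Topology RealInnerProductSpace Laplacian

namespace Summit.NavierStokesRegularity.NavierStokesRegularity.Theorems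

open Literature.Analysis.FluidPDE

/-! ### Time derivative of the mode -/

/-- A function smooth on the open half-line `(−∞, 0)` is differentiable at every `t < 0`, with
derivative `deriv φ t`. -/
theorem galileanMom_hasDerivAt {φ : ℝ → ℝ} (hφ : ContDiffOn ℝ ∞ φ (Iio 0)) {t : ℝ} (ht : t < 0) :
    HasDerivAt φ (deriv φ t) t :=
  ((hφ.differentiableOn (by simp)).differentiableAt (Iio_mem_nhds ht)).hasDerivAt

/-- For `φ` smooth on `(−∞, 0)` and `t < 0`: `(φ')' (t) = iteratedDeriv 2 φ t`, in `HasDerivAt`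
form. -/
theorem galileanMom_hasDerivAt_deriv {φ : ℝ → ℝ} (hφ : ContDiffOn ℝ ∞ φ (Iio 0)) {t : ℝ}
    (ht : t < 0) : HasDerivAt (deriv φ) (iteratedDeriv 2 φ t) t := by
  rw [iteratedDeriv_succ, iteratedDeriv_one]
  exact galileanMom_hasDerivAt (galileanReg_contDiffOn_deriv hφ) ht

/-- **`∂ₜv = φ''e − φ ∂ₑ(∂ₜu) − φ'∂ₑu`** for the modulated Galilean velocity
`v = φ'e − φ∂ₑu` (product rule in time and the exchange `∂ₜ∂ₑu = ∂ₑ∂ₜu`). -/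
theorem galileanMom_timeDeriv
    {u : ℝ → EuclideanSpace ℝ (Fin 3) → EuclideanSpace ℝ (Fin 3)} {φ : ℝ → ℝ}
    (hu : IsSmoothSpaceTimeOn (Iio 0) u) (hφ : ContDiffOn ℝ ∞ φ (Iio 0))
    (e : EuclideanSpace ℝ (Fin 3)) {t : ℝ} (ht : t < 0) (x : EuclideanSpace ℝ (Fin 3)) :
    timeDeriv (fun s y => deriv φ s • e - φ s • fderiv ℝ (u s) y e) t x =
      iteratedDeriv 2 φ t • e -
        (φ t • fderiv ℝ (fun y => deriv (fun s => u s y) t) x e +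
          deriv φ t • fderiv ℝ (u t) x e) := by
  have h1 : HasDerivAt (fun s => deriv φ s • e) (iteratedDeriv 2 φ t • e) t :=
    (galileanMom_hasDerivAt_deriv hφ ht).smul_const e
  have h2 : HasDerivAt (fun s => φ s • fderiv ℝ (u s) x e)
      (φ t • fderiv ℝ (fun y => deriv (fun s => u s y) t) x e +
        deriv φ t • fderiv ℝ (u t) x e) t :=
    (galileanMom_hasDerivAt hφ ht).smul (hu.hasDerivAt_fderiv_slice isOpen_Iio ht x e)
  rw [timeDeriv_apply]
  exact (h1.sub h2).deriv

/-! ### Spatial derivatives of the mode -/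

/-- `D(a e − b ∂ₑu)(x) w = −b D(∂ₑu)(x) w`. -/
theorem galileanMom_fderiv_velocity {Ue : EuclideanSpace ℝ (Fin 3) → EuclideanSpace ℝ (Fin 3)}
    {x : EuclideanSpace ℝ (Fin 3)} (hUe : DifferentiableAt ℝ Ue x) (a b : ℝ)
    (e w : EuclideanSpace ℝ (Fin 3)) :
    fderiv ℝ (fun y => a • e - b • Ue y) x w = -(b • fderiv ℝ Ue x w) := by
  rw [fderiv_const_sub, fderiv_fun_const_smul hUe]
  rfl

/-- `Δ(a e − b ∂ₑu)(x) = −b Δ(∂ₑu)(x)` (the Laplacian of a constant vanishes). -/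
theorem galileanMom_laplacian_velocity
    {Ue : EuclideanSpace ℝ (Fin 3) → EuclideanSpace ℝ (Fin 3)} (hUe : ContDiff ℝ 2 Ue) (a b : ℝ)
    (e x : EuclideanSpace ℝ (Fin 3)) :
    (Δ (fun y => a • e - b • Ue y)) x = -(b • (Δ Ue) x) := by
  have h1 : (fun y => a • e - b • Ue y) = (fun _ => a • e) - b • Ue := by
    funext y
    simp
  have h2 : ContDiffAt ℝ 2 (b • Ue) x := (hUe.const_smul b).contDiffAt
  rw [h1, ContDiffAt.laplacian_sub contDiffAt_const h2, laplacian_smul b hUe.contDiffAt,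
    laplacian_const]
  simp

/-- `∇(−c⟪e, ·⟫ − b ∂ₑp)(x) = −c e − b ∇(∂ₑp)(x)`. -/
theorem galileanMom_gradient_pressure {Pe : EuclideanSpace ℝ (Fin 3) → ℝ}
    {x : EuclideanSpace ℝ (Fin 3)} (hPe : DifferentiableAt ℝ Pe x) (c b : ℝ)
    (e : EuclideanSpace ℝ (Fin 3)) :
    gradient (fun y => -(c * ⟪e, y⟫) - b * Pe y) x = -(c • e) - b • gradient Pe x := by
  have h1 : HasFDerivAt (fun y : EuclideanSpace ℝ (Fin 3) => ⟪e, y⟫)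
      (InnerProductSpace.toDual ℝ (EuclideanSpace ℝ (Fin 3)) e) x :=
    (InnerProductSpace.toDual ℝ (EuclideanSpace ℝ (Fin 3)) e).hasFDerivAt
  have h2 : HasFDerivAt (fun y => -(c * ⟪e, y⟫) - b * Pe y)
      (-(c • InnerProductSpace.toDual ℝ (EuclideanSpace ℝ (Fin 3)) e) - b • fderiv ℝ Pe x) x :=
    (h1.const_mul c).neg.sub (hPe.hasFDerivAt.const_mul b)
  rw [gradient, h2.fderiv, gradient, map_sub, map_neg, map_smul, map_smul,
    LinearIsometryEquiv.symm_apply_apply]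

/-- **`∇(∂ₑp) = ∂ₑ(∇p)`** for a `C²` scalar field (Schwarz, through the Riesz isometry). -/
theorem galileanMom_gradient_fderiv_apply {P : EuclideanSpace ℝ (Fin 3) → ℝ}
    (hP : ContDiff ℝ 2 P) (x e : EuclideanSpace ℝ (Fin 3)) :
    gradient (fun y => fderiv ℝ P y e) x = fderiv ℝ (gradient P) x e := by
  have hd : DifferentiableAt ℝ (fderiv ℝ P) x :=
    ((hP.fderiv_right (m := 1) le_rfl).differentiable one_ne_zero) x
  have h : gradient P = (InnerProductSpace.toDual ℝ (EuclideanSpace ℝ (Fin 3))).symm ∘ fderiv ℝ P :=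
    rfl
  have h2 : fderiv ℝ (gradient P) x e =
      (InnerProductSpace.toDual ℝ (EuclideanSpace ℝ (Fin 3))).symm (fderiv ℝ (fderiv ℝ P) x e) := by
    rw [h, LinearIsometryEquiv.comp_fderiv]
    rfl
  rw [h2, gradient]
  congr 1
  ext w
  rw [← fderiv_apply_const_apply hd w e]
  exact fderiv_fderiv_apply_comm_of_contDiff_two hP x e w

/-- **`∂ₑ((u·∇)u) = Du[∂ₑu] + D(∂ₑu)[u]`** for a `C²` vector field (`fderiv_clm_apply` and
Schwarz). -/
theorem galileanMom_fderiv_convect_self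
    {U : EuclideanSpace ℝ (Fin 3) → EuclideanSpace ℝ (Fin 3)} (hU : ContDiff ℝ 2 U)
    (x e : EuclideanSpace ℝ (Fin 3)) :
    fderiv ℝ (fun y => fderiv ℝ U y (U y)) x e =
      fderiv ℝ U x (fderiv ℝ U x e) + fderiv ℝ (fun y => fderiv ℝ U y e) x (U x) := by
  have hd : DifferentiableAt ℝ (fderiv ℝ U) x :=
    ((hU.fderiv_right (m := 1) le_rfl).differentiable one_ne_zero) x
  have hUd : DifferentiableAt ℝ U x := (hU.differentiable two_ne_zero) x
  rw [fderiv_clm_apply hd hUd, add_apply, ContinuousLinearMap.comp_apply,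
    ContinuousLinearMap.flip_apply, ← fderiv_apply_const_apply hd (U x) e,
    fderiv_fderiv_apply_comm_of_contDiff_two hU x (U x) e]

/-- **The Navier–Stokes equations differentiated along `e`.** If
`∂ₜu + Du[u] = Δu − ∇p` identically in `x` (at a fixed time, with `Ut = ∂ₜu(t, ·)`), then
`∂ₑ(∂ₜu) + (Du[∂ₑu] + D(∂ₑu)[u]) = ∂ₑ(Δu) − ∂ₑ(∇p)` at every `x`. -/
theorem galileanMom_fderiv_navierStokes
    {U Ut : EuclideanSpace ℝ (Fin 3) → EuclideanSpace ℝ (Fin 3)} {P : EuclideanSpace ℝ (Fin 3) → ℝ}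
    (hU : ContDiff ℝ 3 U) (hUt : Differentiable ℝ Ut) (hP : ContDiff ℝ 2 P)
    (hNS : ∀ y, Ut y + fderiv ℝ U y (U y) = (Δ U) y - gradient P y)
    (x e : EuclideanSpace ℝ (Fin 3)) :
    fderiv ℝ Ut x e +
        (fderiv ℝ U x (fderiv ℝ U x e) + fderiv ℝ (fun y => fderiv ℝ U y e) x (U x)) =
      fderiv ℝ (Δ U) x e - fderiv ℝ (gradient P) x e := by
  have hU2 : ContDiff ℝ 2 U := hU.of_le (by norm_num)
  have hd : DifferentiableAt ℝ (fderiv ℝ U) x :=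
    ((hU2.fderiv_right (m := 1) le_rfl).differentiable one_ne_zero) x
  have hUd : DifferentiableAt ℝ U x := (hU2.differentiable two_ne_zero) x
  have hconv : DifferentiableAt ℝ (fun y => fderiv ℝ U y (U y)) x := hd.clm_apply hUd
  have hΔ : DifferentiableAt ℝ (Δ U) x := (differentiable_laplacian hU) x
  have hdP : DifferentiableAt ℝ (fderiv ℝ P) x :=
    ((hP.fderiv_right (m := 1) le_rfl).differentiable one_ne_zero) x
  have hgrad : DifferentiableAt ℝ (gradient P) x :=
    ((InnerProductSpace.toDual ℝ (EuclideanSpace ℝ (Fin 3))).symm.hasFDerivAt.comp x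
      hdP.hasFDerivAt).differentiableAt
  have hfun : (fun y => Ut y + fderiv ℝ U y (U y)) = fun y => (Δ U) y - gradient P y := funext hNS
  have key := congrArg (fun f => fderiv ℝ f x e) hfun
  rw [fderiv_fun_add (hUt x) hconv, fderiv_fun_sub hΔ hgrad, add_apply, sub_apply,
    galileanMom_fderiv_convect_self hU2] at key
  exact key

/-! ### The registered stub -/

/-- **Stub B2b: the Galilean Jacobi identity.** For a classical Navier–Stokes pair `(u, p)`,
jointly smooth on `(−∞, 0) × ℝ³` with `∂ₜu + (u·∇)u = Δu − ∇p` there, a fixed vector `e` and a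
modulation `φ` smooth on `t < 0`, the modulated Galilean mode
`v = φ'e − φ∂ₑu`, `q = −φ''⟪e, x⟫ − φ∂ₑp` solves the linearised momentum equation
`∂ₜv + (u·∇)v + (v·∇)u = Δv − ∇q` for `t < 0`:
`LHS − RHS = −φ ∂ₑ[∂ₜu + (u·∇)u − Δu + ∇p] = 0`. -/
theorem stub_galileanModeMomentum :
    ∀ (u : ℝ → EuclideanSpace ℝ (Fin 3) → EuclideanSpace ℝ (Fin 3))
      (p : ℝ → EuclideanSpace ℝ (Fin 3) → ℝ) (φ : ℝ → ℝ) (e : EuclideanSpace ℝ (Fin 3)),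
      ContDiffOn ℝ (⊤ : ℕ∞) (Function.uncurry u) (Set.Iio 0 ×ˢ Set.univ) →
      ContDiffOn ℝ (⊤ : ℕ∞) (Function.uncurry p) (Set.Iio 0 ×ˢ Set.univ) →
      (∀ t < 0, ∀ x, Literature.Analysis.FluidPDE.timeDeriv u t x +
        Literature.Analysis.FluidPDE.convect (u t) (u t) x =
          Laplacian.laplacian (u t) x - gradient (p t) x) →
      ContDiffOn ℝ (⊤ : ℕ∞) φ (Set.Iio 0) →
      ∀ t < 0, ∀ x,
        Literature.Analysis.FluidPDE.timeDeriv (fun t x => deriv φ t • e - φ t • fderiv ℝ (u t) x e) t x +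
          Literature.Analysis.FluidPDE.convect (u t)
            ((fun t x => deriv φ t • e - φ t • fderiv ℝ (u t) x e) t) x +
          Literature.Analysis.FluidPDE.convect
            ((fun t x => deriv φ t • e - φ t • fderiv ℝ (u t) x e) t) (u t) x =
        Laplacian.laplacian ((fun t x => deriv φ t • e - φ t • fderiv ℝ (u t) x e) t) x -
          gradient ((fun t x => -(iteratedDeriv 2 φ t * inner ℝ e x) - φ t * fderiv ℝ (p t) x e) t) x := by
  intro u p φ e hu hp hNS hφ t ht x
  beta_reduce
  have huS : IsSmoothSpaceTimeOn (Iio 0) u := hu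
  have hpS : IsSmoothSpaceTimeOn (Iio 0) p := hp
  have ht' : t ∈ Iio 0 := ht
  -- the slices at time `t` are smooth
  have hU : ContDiff ℝ ∞ (u t) := huS.contDiff_slice ht'
  have hU2 : ContDiff ℝ 2 (u t) := contDiff_infty.1 hU 2
  have hU3 : ContDiff ℝ 3 (u t) := contDiff_infty.1 hU 3
  have hP2 : ContDiff ℝ 2 (p t) := contDiff_infty.1 (hpS.contDiff_slice ht') 2
  have hUe : ContDiff ℝ ∞ (fun y => fderiv ℝ (u t) y e) :=
    (huS.isSmoothSpaceTimeOn_fderiv_apply isOpen_Iio e).contDiff_slice ht'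
  have hUt : ContDiff ℝ ∞ (fun y => deriv (fun s => u s y) t) :=
    (huS.isSmoothSpaceTimeOn_deriv isOpen_Iio).contDiff_slice ht'
  have hPe : ContDiff ℝ ∞ (fun y => fderiv ℝ (p t) y e) :=
    (hpS.isSmoothSpaceTimeOn_fderiv_apply isOpen_Iio e).contDiff_slice ht'
  have hUed : DifferentiableAt ℝ (fun y => fderiv ℝ (u t) y e) x :=
    (hUe.differentiable (by simp)) x
  have hPed : DifferentiableAt ℝ (fun y => fderiv ℝ (p t) y e) x :=
    (hPe.differentiable (by simp)) x
  -- the Navier–Stokes equations at time `t`, differentiated along `e`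
  have hNSt : ∀ y, deriv (fun s => u s y) t + fderiv ℝ (u t) y (u t y) =
      (Δ (u t)) y - gradient (p t) y := fun y => hNS t ht y
  have key := galileanMom_fderiv_navierStokes hU3 (hUt.differentiable (by simp)) hP2 hNSt x e
  have hD : fderiv ℝ (Δ (u t)) x e = fderiv ℝ (fun y => deriv (fun s => u s y) t) x e +
      (fderiv ℝ (u t) x (fderiv ℝ (u t) x e) +
        fderiv ℝ (fun y => fderiv ℝ (u t) y e) x (u t x)) +
      fderiv ℝ (gradient (p t)) x e := by
    rw [key, sub_add_cancel]
  -- the five terms of the linearised equation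
  have e1 := galileanMom_timeDeriv huS hφ e ht x
  have e2 : convect (u t) (fun y => deriv φ t • e - φ t • fderiv ℝ (u t) y e) x =
      -(φ t • fderiv ℝ (fun y => fderiv ℝ (u t) y e) x (u t x)) :=
    galileanMom_fderiv_velocity hUed (deriv φ t) (φ t) e (u t x)
  have e3 : convect (fun y => deriv φ t • e - φ t • fderiv ℝ (u t) y e) (u t) x =
      deriv φ t • fderiv ℝ (u t) x e - φ t • fderiv ℝ (u t) x (fderiv ℝ (u t) x e) := by
    simp only [convect_apply, map_sub, map_smul]
  have e4 : (Δ (fun y => deriv φ t • e - φ t • fderiv ℝ (u t) y e)) x =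
      -(φ t • fderiv ℝ (Δ (u t)) x e) := by
    rw [fderiv_laplacian_apply_of_contDiff_three hU3 x e]
    exact galileanMom_laplacian_velocity (contDiff_infty.1 hUe 2) (deriv φ t) (φ t) e x
  have e5 : gradient (fun y => -(iteratedDeriv 2 φ t * ⟪e, y⟫) - φ t * fderiv ℝ (p t) y e) x =
      -(iteratedDeriv 2 φ t • e) - φ t • fderiv ℝ (gradient (p t)) x e := by
    rw [← galileanMom_gradient_fderiv_apply hP2 x e]
    exact galileanMom_gradient_pressure hPed (iteratedDeriv 2 φ t) (φ t) e
  rw [e1, e2, e3, e4, e5, hD]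
  module

end Summit.NavierStokesRegularity.NavierStokesRegularity.Theorems
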